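import Summits.ABC.ABC.Theses.RibetTakahashiSplit
import Literature.NumberTheory.EllipticCurves.SzpiroFreyCurveProofs
import Mathlib.NumberTheory.Primorial

/-!
# `ManyPrimeValuationProduct` (stmt-ABC-1561), line `unramified-window-census`: the test family
`F(M, j) : y² = x (x + 1) (x + 32 M^j)` inside the class

Negative support (drefute seat `refuter-drefute-stmt-ABC-1561-0`, 2026-08-16). The line
`Cruxes/ManyPrimeValuationProduct/Lines/unramified-window-census.lean` (rev 2) splits the crux into
`stub_midCensus` (∀ ε > 0 ∃ C, `#{p ∥ N : (log N)^ε < v_p} · log log N ≤ ε log N + C`) and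
`stub_giantMass` (∀ ε > 0 ∃ C, `Σ_{p ∥ N, v_p > log N} log v_p ≤ ε log N + C`), `v_p = ord_p Δ_min`, on the
class of curves semistable away from `2` with `≥ 4` odd multiplicative primes. This file certifies the
Frey family on which the degenerate instances of both stubs fail (`Negative/WindowCensusDegenerate.lean`):

* `F(M, j) = freyCurve (-1) (32 M^j)`, the Serre-normalised Frey curve of the triple
  `(−1) + 32 M^j = 32 M^j − 1`: `N = rad (32 M^j (32 M^j − 1))` and `2⁸ Δ_min = (32 M^j (32 M^j − 1))²`
  (`conductorNorm_freyCurve_of_mod_holds`, `minimalDiscriminantNorm_freyCurve_of_mod_holds`), hence `N` is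
  squarefree, every prime of `M` is multiplicative, `p^{2jt} ∣ Δ_min` whenever `p^t ∣ M` (`p` odd), and the
  curve lies in the class as soon as `1155 ∣ M` (`family_semistable`, `family_four_le_card`);
* the primorial instance `M = n#` (every odd prime `≤ n` is multiplicative with `v_p ≥ 2j`;
  `exists_many_oddPrimes`), the sub-family `H(t) = F(385·3^t, 1)` in which `3` is a giant prime
  (`log N < 2t ≤ v_3` for `t ≥ 20`, `familyH_three_giant`), and two numerical facts (`3 < log 21`,
  `1 < log log N` for `N ≥ 21`).
-/

noncomputable section

-- `Summit.<Summit>.<Problem>`: for the single-conjunct summit `ABC` the duplicate `ABC.ABC` is mandated.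
set_option linter.dupNamespace false

namespace Summit.ABC.ABC.Theorems.ManyPrimeValuationProduct.Negative

open Literature.NumberTheory.EllipticCurves UniqueFactorizationMonoid Real Finset

/-! ## §1 The family `F(M, j) = freyCurve (-1) (32 M^j)` -/

/-- `1 ≤ 32 M^j` for `1 ≤ M` (so that `32 M^j − 1` is an honest natural number). [folklore] -/
theorem one_le_param (M j : ℕ) (hM : 1 ≤ M) : 1 ≤ 32 * M ^ j :=
  le_trans (Nat.one_le_pow j M hM) (Nat.le_mul_of_pos_left _ (by norm_num))

/-- The Serre-normalisation hypotheses of the triple `(−1, 32 M^j)`: coprime, non-degenerate,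
`−1 ≡ −1 (mod 4)`, `32 ∣ 32 M^j`. [folklore] -/
theorem family_hyps (M j : ℕ) (hM : 1 ≤ M) :
    IsCoprime (-1 : ℤ) (32 * (M : ℤ) ^ j) ∧
      (-1 : ℤ) * (32 * (M : ℤ) ^ j) * (-1 + 32 * (M : ℤ) ^ j) ≠ 0 ∧
      (-1 : ℤ) ≡ -1 [ZMOD 4] ∧ (32 : ℤ) ∣ 32 * (M : ℤ) ^ j := by
  refine ⟨isCoprime_one_left.neg_left, ?_, Int.ModEq.refl _, dvd_mul_right _ _⟩
  have h1 : (1 : ℤ) ≤ (M : ℤ) ^ j := one_le_pow₀ (by exact_mod_cast hM)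
  have h2 : (-1 : ℤ) * (32 * (M : ℤ) ^ j) * (-1 + 32 * (M : ℤ) ^ j)
      = -((32 * (M : ℤ) ^ j) * (-1 + 32 * (M : ℤ) ^ j)) := by ring
  rw [h2, neg_ne_zero]
  exact mul_ne_zero (by positivity) (by linarith)

/-- The product `a b (a + b)` of the triple as the negative of a natural number. [folklore] -/
theorem family_abc_eq (M j : ℕ) (hM : 1 ≤ M) :
    (-1 : ℤ) * (32 * (M : ℤ) ^ j) * (-1 + 32 * (M : ℤ) ^ j)
      = -(((32 * M ^ j * (32 * M ^ j - 1) : ℕ) : ℤ)) := by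
  have h1 := one_le_param M j hM
  push_cast [Nat.cast_sub h1]
  ring

/-- `32 M^j (32 M^j − 1) ≠ 0`. [folklore] -/
theorem family_param_ne_zero (M j : ℕ) (hM : 1 ≤ M) : 32 * M ^ j * (32 * M ^ j - 1) ≠ 0 := by
  have h1 : 1 ≤ M ^ j := Nat.one_le_pow j M hM
  have h32 : 32 ≤ 32 * M ^ j := by omega
  exact Nat.mul_ne_zero (by omega) (by omega)

/-- The Frey curve `F(M, j)` is an elliptic curve. [folklore] -/
theorem family_isElliptic (M j : ℕ) (hM : 1 ≤ M) :
    (freyCurve (-1) (32 * (M : ℤ) ^ j)).IsElliptic :=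
  isElliptic_freyCurve (family_hyps M j hM).2.1

/-- **Conductor of the family**: `N (F(M,j)) = rad (32 M^j (32 M^j − 1))` (Serre normalisation,
`conductorNorm_freyCurve_of_mod_holds`). [folklore] -/
theorem family_conductorNorm (M j : ℕ) (hM : 1 ≤ M) :
    (freyCurve (-1) (32 * (M : ℤ) ^ j)).conductorNorm ℤ = radical (32 * M ^ j * (32 * M ^ j - 1)) := by
  obtain ⟨hab, h0, ha, hb⟩ := family_hyps M j hM
  have h := conductorNorm_freyCurve_of_mod_holds (-1) (32 * (M : ℤ) ^ j) hab h0 ha hb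
  rw [h, family_abc_eq M j hM, UniqueFactorizationDomain.radical_neg, Int.radical_natCast, Int.natAbs_natCast]

/-- **Minimal discriminant of the family**: `2⁸ Δ_min (F(M,j)) = (32 M^j (32 M^j − 1))²`
(`minimalDiscriminantNorm_freyCurve_of_mod_holds`). [folklore] -/
theorem family_minimalDiscriminantNorm (M j : ℕ) (hM : 1 ≤ M) :
    2 ^ 8 * (freyCurve (-1) (32 * (M : ℤ) ^ j)).minimalDiscriminantNorm ℤ
      = (32 * M ^ j * (32 * M ^ j - 1)) ^ 2 := by
  obtain ⟨hab, h0, ha, hb⟩ := family_hyps M j hM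
  have h := minimalDiscriminantNorm_freyCurve_of_mod_holds (-1) (32 * (M : ℤ) ^ j) hab h0 ha hb
  rw [h, family_abc_eq M j hM, neg_sq, ← Nat.cast_pow, Int.natAbs_natCast]

/-- The conductor of `F(M, j)` is squarefree (semistable everywhere). [folklore] -/
theorem family_squarefree (M j : ℕ) (hM : 1 ≤ M) :
    Squarefree ((freyCurve (-1) (32 * (M : ℤ) ^ j)).conductorNorm ℤ) := by
  rw [family_conductorNorm M j hM]
  exact squarefree_radical

/-- No prime square divides the conductor of `F(M, j)`. [folklore] -/
theorem family_not_sq_dvd (M j : ℕ) (hM : 1 ≤ M) (p : ℕ) (hp : p.Prime) :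
    ¬ p ^ 2 ∣ (freyCurve (-1) (32 * (M : ℤ) ^ j)).conductorNorm ℤ := by
  rw [pow_two]
  exact (Nat.squarefree_iff_prime_squarefree.mp (family_squarefree M j hM)) p hp

/-- The prime factors of the conductor of `F(M, j)` are those of `32 M^j (32 M^j − 1)`. [folklore] -/
theorem family_primeFactors (M j : ℕ) (hM : 1 ≤ M) :
    ((freyCurve (-1) (32 * (M : ℤ) ^ j)).conductorNorm ℤ).primeFactors
      = (32 * M ^ j * (32 * M ^ j - 1)).primeFactors := by
  rw [family_conductorNorm M j hM, Nat.primeFactors_radical]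

/-- Every prime of `M` is a (multiplicative) prime of the conductor of `F(M, j)`, `j ≥ 1`. [folklore] -/
theorem family_mem_primeFactors (M j : ℕ) (hM : 1 ≤ M) (hj : 1 ≤ j) {p : ℕ} (hp : p.Prime)
    (hpM : p ∣ M) : p ∈ ((freyCurve (-1) (32 * (M : ℤ) ^ j)).conductorNorm ℤ).primeFactors := by
  rw [family_primeFactors M j hM, Nat.mem_primeFactors]
  refine ⟨hp, ?_, family_param_ne_zero M j hM⟩
  exact Dvd.dvd.mul_right (Dvd.dvd.mul_left (dvd_trans hpM (dvd_pow_self M (by omega))) 32) _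

/-- The minimal discriminant norm of `F(M, j)` is nonzero. [folklore] -/
theorem family_minDisc_ne_zero (M j : ℕ) (hM : 1 ≤ M) :
    (freyCurve (-1) (32 * (M : ℤ) ^ j)).minimalDiscriminantNorm ℤ ≠ 0 := by
  intro h0
  have h := family_minimalDiscriminantNorm M j hM
  rw [h0, mul_zero] at h
  exact pow_ne_zero 2 (family_param_ne_zero M j hM) h.symm

/-- **Deep Tate periods in the family**: for an odd prime `p ∣ M`, `p^{2j} ∣ Δ_min (F(M,j))`. [folklore] -/
theorem family_pow_dvd_minDisc (M j : ℕ) (hM : 1 ≤ M) {p : ℕ} (hp : p.Prime) (hp2 : p ≠ 2)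
    (hpM : p ∣ M) : p ^ (2 * j) ∣ (freyCurve (-1) (32 * (M : ℤ) ^ j)).minimalDiscriminantNorm ℤ := by
  have h := family_minimalDiscriminantNorm M j hM
  have hdvd : p ^ (2 * j) ∣ (32 * M ^ j * (32 * M ^ j - 1)) ^ 2 := by
    have h1 : p ^ j ∣ 32 * M ^ j * (32 * M ^ j - 1) :=
      Dvd.dvd.mul_right (Dvd.dvd.mul_left (pow_dvd_pow_of_dvd hpM j) 32) _
    have h2 := pow_dvd_pow_of_dvd h1 2
    rwa [← pow_mul, mul_comm j 2] at h2
  rw [← h] at hdvd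
  have hcop : Nat.Coprime (p ^ (2 * j)) (2 ^ 8) :=
    Nat.Coprime.pow _ _ ((Nat.coprime_primes hp Nat.prime_two).mpr hp2)
  exact hcop.dvd_of_dvd_mul_left hdvd

/-- Hence `2j ≤ v_p = ord_p Δ_min (F(M,j))` for an odd prime `p ∣ M`. [folklore] -/
theorem family_le_factorization (M j : ℕ) (hM : 1 ≤ M) {p : ℕ} (hp : p.Prime) (hp2 : p ≠ 2)
    (hpM : p ∣ M) :
    2 * j ≤ ((freyCurve (-1) (32 * (M : ℤ) ^ j)).minimalDiscriminantNorm ℤ).factorization p :=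
  (hp.pow_dvd_iff_le_factorization (family_minDisc_ne_zero M j hM)).mp
    (family_pow_dvd_minDisc M j hM hp hp2 hpM)

/-- The class hypothesis "semistable away from `2`" for the family. [folklore] -/
theorem family_semistable (M j : ℕ) (hM : 1 ≤ M) :
    ∀ p : ℕ, p.Prime → p ≠ 2 → ¬ p ^ 2 ∣ (freyCurve (-1) (32 * (M : ℤ) ^ j)).conductorNorm ℤ :=
  fun p hp _ => family_not_sq_dvd M j hM p hp

/-- The class hypothesis "at least four odd multiplicative primes" for the family, when
`3, 5, 7, 11 ∣ M`. [folklore] -/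
theorem family_four_le_card (M j : ℕ) (hM : 1 ≤ M) (hj : 1 ≤ j) (h1155 : 1155 ∣ M) :
    4 ≤ (((freyCurve (-1) (32 * (M : ℤ) ^ j)).conductorNorm ℤ).primeFactors.filter
      (fun p => p ≠ 2 ∧ ¬ p ^ 2 ∣ (freyCurve (-1) (32 * (M : ℤ) ^ j)).conductorNorm ℤ)).card := by
  have hsub : ({3, 5, 7, 11} : Finset ℕ) ⊆
      ((freyCurve (-1) (32 * (M : ℤ) ^ j)).conductorNorm ℤ).primeFactors.filter
        (fun p => p ≠ 2 ∧ ¬ p ^ 2 ∣ (freyCurve (-1) (32 * (M : ℤ) ^ j)).conductorNorm ℤ) := by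
    intro p hp
    simp only [Finset.mem_insert, Finset.mem_singleton] at hp
    rw [Finset.mem_filter]
    have hpp : p.Prime ∧ p ≠ 2 ∧ p ∣ 1155 := by
      rcases hp with rfl | rfl | rfl | rfl <;> refine ⟨by norm_num, by norm_num, by norm_num⟩
    exact ⟨family_mem_primeFactors M j hM hj hpp.1 (dvd_trans hpp.2.2 h1155),
      hpp.2.1, family_not_sq_dvd M j hM p hpp.1⟩
  exact le_trans (by decide) (Finset.card_le_card hsub)

/-- **Counting lemma**: every finite set `P` of odd primes dividing `M` injects into the set of
multiplicative primes of `F(M, j)` satisfying any property implied by `2j ≤ v_p`. [folklore] -/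
theorem family_card_le (M j : ℕ) (hM : 1 ≤ M) (hj : 1 ≤ j) (P : Finset ℕ)
    (hP : ∀ p ∈ P, p.Prime ∧ p ≠ 2 ∧ p ∣ M) (Q : ℕ → Prop) [DecidablePred Q]
    (hQ : ∀ p ∈ P, 2 * j ≤ ((freyCurve (-1) (32 * (M : ℤ) ^ j)).minimalDiscriminantNorm ℤ).factorization p → Q p) :
    P.card ≤ ((((freyCurve (-1) (32 * (M : ℤ) ^ j)).conductorNorm ℤ).primeFactors.filter
      (fun p => ¬ p ^ 2 ∣ (freyCurve (-1) (32 * (M : ℤ) ^ j)).conductorNorm ℤ)).filter Q).card := by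
  refine Finset.card_le_card fun p hp => ?_
  obtain ⟨hpp, hp2, hpM⟩ := hP p hp
  rw [Finset.mem_filter, Finset.mem_filter]
  exact ⟨⟨family_mem_primeFactors M j hM hj hpp hpM, family_not_sq_dvd M j hM p hpp⟩,
    hQ p hp (family_le_factorization M j hM hpp hp2 hpM)⟩

/-! ### The primorial instance `M = n#` -/

/-- The odd primes `≤ n` all divide `n#`. [folklore] -/
theorem oddPrimesLE_spec (n : ℕ) :
    ∀ p ∈ (Nat.primesLE n).filter (· ≠ 2), p.Prime ∧ p ≠ 2 ∧ p ∣ primorial n := by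
  intro p hp
  rw [Finset.mem_filter, Nat.mem_primesLE] at hp
  exact ⟨hp.1.2, hp.2, (Nat.Prime.dvd_primorial_iff hp.1.2).mpr hp.1.1⟩

/-- There are `π(n) − 1` odd primes `≤ n` (`n ≥ 2`). [folklore] -/
theorem card_oddPrimesLE (n : ℕ) (hn : 2 ≤ n) :
    ((Nat.primesLE n).filter (· ≠ 2)).card = Nat.primeCounting n - 1 := by
  have h2 : 2 ∈ Nat.primesLE n := Nat.mem_primesLE.mpr ⟨hn, Nat.prime_two⟩
  rw [Finset.filter_ne', Finset.card_erase_of_mem h2, Nat.primesLE_card_eq_primeCounting]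

/-- `1155 = 3·5·7·11` divides `n#` for `n ≥ 11`. [folklore] -/
theorem dvd_primorial_1155 (n : ℕ) (hn : 11 ≤ n) : 1155 ∣ primorial n := by
  have h : ∀ p ∈ ({3, 5, 7, 11} : Finset ℕ), p.Prime ∧ p ≤ n := by
    intro p hp
    simp only [Finset.mem_insert, Finset.mem_singleton] at hp
    rcases hp with rfl | rfl | rfl | rfl <;> exact ⟨by norm_num, by omega⟩
  have hprod : ∏ p ∈ ({3, 5, 7, 11} : Finset ℕ), p = 1155 := by decide
  rw [← hprod]
  refine Finset.prod_primes_dvd _ (fun p hp => (h p hp).1.prime) ?_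
  intro p hp
  exact (Nat.Prime.dvd_primorial_iff (h p hp).1).mpr (h p hp).2

/-- For every `K` there is `n ≥ 11` with at least `K` odd primes `≤ n`. [folklore] -/
theorem exists_many_oddPrimes (K : ℕ) :
    ∃ n : ℕ, 11 ≤ n ∧ K ≤ ((Nat.primesLE n).filter (· ≠ 2)).card := by
  obtain ⟨n, hn⟩ := Nat.surjective_primeCounting (K + 6)
  have hn11 : 11 ≤ n := by
    by_contra h
    have hmono := Nat.monotone_primeCounting (show n ≤ 10 by omega)
    have h10 : Nat.primeCounting 10 = 4 := by decide
    omega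
  refine ⟨n, hn11, ?_⟩
  rw [card_oddPrimesLE n (by omega), hn]
  omega

/-! ### Two numerical facts about logarithms -/

/-- `3 < log 21` (`e³ = 20.08… < 21`). [folklore] -/
theorem three_lt_log_21 : (3 : ℝ) < Real.log 21 := by
  rw [Real.lt_log_iff_exp_lt (by norm_num)]
  have h := Real.exp_one_lt_d9
  have h3 : Real.exp 3 = Real.exp 1 ^ 3 := by rw [← Real.exp_nat_mul]; norm_num
  rw [h3]
  have h0 : 0 < Real.exp 1 := Real.exp_pos 1
  calc Real.exp 1 ^ 3 < (2.7182818286 : ℝ) ^ 3 := by gcongr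
    _ < 21 := by norm_num

/-- On the class (indeed whenever `N ≥ 21`): `1 < log log N`. [folklore] -/
theorem one_lt_loglog {N : ℕ} (hN : 21 ≤ N) : 1 < Real.log (Real.log N) := by
  have hL : (3 : ℝ) < Real.log N :=
    lt_of_lt_of_le three_lt_log_21 (Real.log_le_log (by norm_num) (by exact_mod_cast hN))
  have h3 : (1 : ℝ) < Real.log 3 := by
    rw [Real.lt_log_iff_exp_lt (by norm_num)]
    exact lt_trans Real.exp_one_lt_d9 (by norm_num)
  exact lt_trans h3 (Real.log_lt_log (by norm_num) hL)

/-- The conductor of a family member with `1155 ∣ M`, `j ≥ 1` is at least `1155`. [folklore] -/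
theorem family_conductorNorm_ge (M j : ℕ) (hM : 1 ≤ M) (hj : 1 ≤ j) (h1155 : 1155 ∣ M) :
    1155 ≤ (freyCurve (-1) (32 * (M : ℤ) ^ j)).conductorNorm ℤ := by
  have hprod : ∏ p ∈ ({3, 5, 7, 11} : Finset ℕ), p = 1155 := by decide
  have h : ∀ p ∈ ({3, 5, 7, 11} : Finset ℕ), p.Prime ∧ p ∣ 1155 := by
    intro p hp
    simp only [Finset.mem_insert, Finset.mem_singleton] at hp
    rcases hp with rfl | rfl | rfl | rfl <;> exact ⟨by norm_num, by norm_num⟩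
  have hdvd : 1155 ∣ (freyCurve (-1) (32 * (M : ℤ) ^ j)).conductorNorm ℤ := by
    rw [← hprod]
    refine Finset.prod_primes_dvd _ (fun p hp => (h p hp).1.prime) ?_
    intro p hp
    exact Nat.dvd_of_mem_primeFactors
      (family_mem_primeFactors M j hM hj (h p hp).1 (dvd_trans (h p hp).2 h1155))
  haveI := family_isElliptic M j hM
  exact Nat.le_of_dvd (WeierstrassCurve.conductorNorm_pos_holds _) hdvd


/-- With multiplicity: if `p^t ∣ M` for an odd prime `p` then `p^{2jt} ∣ Δ_min (F(M,j))`. [folklore] -/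
theorem family_pow_mul_dvd_minDisc (M j t : ℕ) (hM : 1 ≤ M) {p : ℕ} (hp : p.Prime) (hp2 : p ≠ 2)
    (hpM : p ^ t ∣ M) :
    p ^ (2 * j * t) ∣ (freyCurve (-1) (32 * (M : ℤ) ^ j)).minimalDiscriminantNorm ℤ := by
  have h := family_minimalDiscriminantNorm M j hM
  have hdvd : p ^ (2 * j * t) ∣ (32 * M ^ j * (32 * M ^ j - 1)) ^ 2 := by
    have h1 : p ^ (t * j) ∣ 32 * M ^ j * (32 * M ^ j - 1) := by
      rw [pow_mul]
      exact Dvd.dvd.mul_right (Dvd.dvd.mul_left (pow_dvd_pow_of_dvd hpM j) 32) _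
    have h2 := pow_dvd_pow_of_dvd h1 2
    rwa [← pow_mul, show t * j * 2 = 2 * j * t by ring] at h2
  rw [← h] at hdvd
  have hcop : Nat.Coprime (p ^ (2 * j * t)) (2 ^ 8) :=
    Nat.Coprime.pow _ _ ((Nat.coprime_primes hp Nat.prime_two).mpr hp2)
  exact hcop.dvd_of_dvd_mul_left hdvd

/-- Hence `2jt ≤ v_p (F(M,j))` when `p^t ∣ M`, `p` an odd prime. [folklore] -/
theorem family_le_factorization' (M j t : ℕ) (hM : 1 ≤ M) {p : ℕ} (hp : p.Prime) (hp2 : p ≠ 2)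
    (hpM : p ^ t ∣ M) :
    2 * j * t ≤ ((freyCurve (-1) (32 * (M : ℤ) ^ j)).minimalDiscriminantNorm ℤ).factorization p :=
  (hp.pow_dvd_iff_le_factorization (family_minDisc_ne_zero M j hM)).mp
    (family_pow_mul_dvd_minDisc M j t hM hp hp2 hpM)

/-! ### The sub-family `H(t) = F(385·3^t, 1)`: one giant prime -/

/-- The conductor of `H(t)` divides `2310 · (32·385·3^t − 1)`. [folklore] -/
theorem familyH_conductorNorm_dvd (t : ℕ) :
    (freyCurve (-1) (32 * ((385 * 3 ^ t : ℕ) : ℤ) ^ 1)).conductorNorm ℤ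
      ∣ 2310 * (32 * (385 * 3 ^ t) ^ 1 - 1) := by
  have hM : 1 ≤ 385 * 3 ^ t := le_trans (Nat.one_le_pow t 3 (by norm_num)) (by omega)
  rw [family_conductorNorm (385 * 3 ^ t) 1 hM, Nat.radical_eq_prod_primeFactors]
  refine Finset.prod_primes_dvd _ (fun p hp => (Nat.prime_of_mem_primeFactors hp).prime) ?_
  intro p hp
  have hpp := Nat.prime_of_mem_primeFactors hp
  have hpd := Nat.dvd_of_mem_primeFactors hp
  rcases (Nat.Prime.dvd_mul hpp).mp hpd with h1 | h2
  · -- `p ∣ 32 · (385 · 3^t)`: then `p ∈ {2, 3, 5, 7, 11}`, all dividing `2310`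
    refine Dvd.dvd.mul_right ?_ _
    rw [pow_one] at h1
    rcases (Nat.Prime.dvd_mul hpp).mp h1 with h32 | h385
    · have := (Nat.prime_dvd_prime_iff_eq hpp Nat.prime_two).mp
        (hpp.dvd_of_dvd_pow (show p ∣ 2 ^ 5 by simpa using h32))
      subst this; norm_num
    · rcases (Nat.Prime.dvd_mul hpp).mp h385 with h385' | h3
      · exact dvd_trans h385' (by norm_num)
      · have := (Nat.prime_dvd_prime_iff_eq hpp Nat.prime_three).mp (hpp.dvd_of_dvd_pow h3)
        subst this; norm_num
  · exact Dvd.dvd.mul_left h2 _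

/-- `log N (H(t)) < 25 log 2 + t · (8/5) log 2` (from `N ≤ 2310·32·385·3^t < 2^25 · 3^t` and
`3^5 < 2^8`). [folklore] -/
theorem familyH_log_conductorNorm_lt (t : ℕ) :
    Real.log ((freyCurve (-1) (32 * ((385 * 3 ^ t : ℕ) : ℤ) ^ 1)).conductorNorm ℤ)
      < 25 * Real.log 2 + t * (8 / 5 * Real.log 2) := by
  have hM : 1 ≤ 385 * 3 ^ t := le_trans (Nat.one_le_pow t 3 (by norm_num)) (by omega)
  haveI := family_isElliptic (385 * 3 ^ t) 1 hM
  have hNpos : 0 < (freyCurve (-1) (32 * ((385 * 3 ^ t : ℕ) : ℤ) ^ 1)).conductorNorm ℤ :=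
    WeierstrassCurve.conductorNorm_pos_holds _
  have hdvd := familyH_conductorNorm_dvd t
  have hle : (freyCurve (-1) (32 * ((385 * 3 ^ t : ℕ) : ℤ) ^ 1)).conductorNorm ℤ
      ≤ 2310 * (32 * (385 * 3 ^ t) ^ 1 - 1) :=
    Nat.le_of_dvd (Nat.mul_pos (by norm_num) (by
      have : 1 ≤ (385 * 3 ^ t) ^ 1 := by rw [pow_one]; exact hM
      omega)) hdvd
  have hlt : 2310 * (32 * (385 * 3 ^ t) ^ 1 - 1) < 2 ^ 25 * 3 ^ t := by
    rw [pow_one]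
    have : 1 ≤ 3 ^ t := Nat.one_le_pow t 3 (by norm_num)
    omega
  have hN : ((freyCurve (-1) (32 * ((385 * 3 ^ t : ℕ) : ℤ) ^ 1)).conductorNorm ℤ : ℝ)
      < (2 : ℝ) ^ 25 * (3 : ℝ) ^ t := by exact_mod_cast lt_of_le_of_lt hle hlt
  have h35 : Real.log 3 < 8 / 5 * Real.log 2 := by
    have h : (3 : ℝ) ^ (5 : ℕ) < (2 : ℝ) ^ (8 : ℕ) := by norm_num
    have := Real.log_lt_log (by norm_num) h
    rw [Real.log_pow, Real.log_pow] at this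
    push_cast at this
    linarith
  calc Real.log ((freyCurve (-1) (32 * ((385 * 3 ^ t : ℕ) : ℤ) ^ 1)).conductorNorm ℤ)
      < Real.log ((2 : ℝ) ^ 25 * (3 : ℝ) ^ t) := Real.log_lt_log (by exact_mod_cast hNpos) hN
    _ = 25 * Real.log 2 + t * Real.log 3 := by
        rw [Real.log_mul (by positivity) (by positivity), Real.log_pow, Real.log_pow]; push_cast; ring
    _ ≤ 25 * Real.log 2 + t * (8 / 5 * Real.log 2) := by gcongr

/-- For `t ≥ 20` the prime `3` is GIANT for `H(t)`: `log N < 2t ≤ v_3`. [folklore] -/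
theorem familyH_three_giant (t : ℕ) (ht : 20 ≤ t) :
    Real.log ((freyCurve (-1) (32 * ((385 * 3 ^ t : ℕ) : ℤ) ^ 1)).conductorNorm ℤ)
      < ((((freyCurve (-1) (32 * ((385 * 3 ^ t : ℕ) : ℤ) ^ 1)).minimalDiscriminantNorm ℤ).factorization 3
          : ℕ) : ℝ) := by
  have hM : 1 ≤ 385 * 3 ^ t := le_trans (Nat.one_le_pow t 3 (by norm_num)) (by omega)
  have hv : 2 * 1 * t ≤ (((freyCurve (-1) (32 * ((385 * 3 ^ t : ℕ) : ℤ) ^ 1)).minimalDiscriminantNorm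
      ℤ).factorization 3) :=
    family_le_factorization' (385 * 3 ^ t) 1 t hM Nat.prime_three (by norm_num) (dvd_mul_left _ _)
  have hv' : (2 * t : ℝ) ≤ ((((freyCurve (-1) (32 * ((385 * 3 ^ t : ℕ) : ℤ) ^ 1)).minimalDiscriminantNorm
      ℤ).factorization 3 : ℕ) : ℝ) := by exact_mod_cast (by simpa using hv)
  have hlog := familyH_log_conductorNorm_lt t
  have h2 := Real.log_two_lt_d9
  have ht' : (20 : ℝ) ≤ t := by exact_mod_cast ht
  nlinarith

/-- The giant mass of `H(t)`, `t ≥ 20`, is at least `log (2t)`. [folklore] -/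
theorem familyH_giantMass_ge (t : ℕ) (ht : 20 ≤ t) :
    Real.log (2 * t) ≤
      ∑ p ∈ (((freyCurve (-1) (32 * ((385 * 3 ^ t : ℕ) : ℤ) ^ 1)).conductorNorm ℤ).primeFactors.filter
          (fun p => ¬ p ^ 2 ∣ (freyCurve (-1) (32 * ((385 * 3 ^ t : ℕ) : ℤ) ^ 1)).conductorNorm ℤ)).filter
          (fun p => Real.log ((freyCurve (-1) (32 * ((385 * 3 ^ t : ℕ) : ℤ) ^ 1)).conductorNorm ℤ) <
            ((((freyCurve (-1) (32 * ((385 * 3 ^ t : ℕ) : ℤ) ^ 1)).minimalDiscriminantNorm ℤ).factorization p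
              : ℕ) : ℝ)),
        Real.log (((freyCurve (-1) (32 * ((385 * 3 ^ t : ℕ) : ℤ) ^ 1)).minimalDiscriminantNorm
          ℤ).factorization p) := by
  have hM : 1 ≤ 385 * 3 ^ t := le_trans (Nat.one_le_pow t 3 (by norm_num)) (by omega)
  have h3mem : 3 ∈ (((freyCurve (-1) (32 * ((385 * 3 ^ t : ℕ) : ℤ) ^ 1)).conductorNorm ℤ).primeFactors.filter
          (fun p => ¬ p ^ 2 ∣ (freyCurve (-1) (32 * ((385 * 3 ^ t : ℕ) : ℤ) ^ 1)).conductorNorm ℤ)).filter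
          (fun p => Real.log ((freyCurve (-1) (32 * ((385 * 3 ^ t : ℕ) : ℤ) ^ 1)).conductorNorm ℤ) <
            ((((freyCurve (-1) (32 * ((385 * 3 ^ t : ℕ) : ℤ) ^ 1)).minimalDiscriminantNorm ℤ).factorization p
              : ℕ) : ℝ)) := by
    rw [Finset.mem_filter, Finset.mem_filter]
    have h1 : 1 ≤ t := by omega
    exact ⟨⟨family_mem_primeFactors (385 * 3 ^ t) 1 hM le_rfl Nat.prime_three
        (dvd_trans (dvd_pow_self 3 (by omega)) (dvd_mul_left _ _)),
      family_not_sq_dvd _ 1 hM 3 Nat.prime_three⟩, familyH_three_giant t ht⟩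
  have hv : 2 * 1 * t ≤ (((freyCurve (-1) (32 * ((385 * 3 ^ t : ℕ) : ℤ) ^ 1)).minimalDiscriminantNorm
      ℤ).factorization 3) :=
    family_le_factorization' (385 * 3 ^ t) 1 t hM Nat.prime_three (by norm_num) (dvd_mul_left _ _)
  refine le_trans ?_ (Finset.single_le_sum (fun p _ => Real.log_natCast_nonneg _) h3mem)
  exact Real.log_le_log (by positivity) (by exact_mod_cast (by simpa using hv))


end Summit.ABC.ABC.Theorems.ManyPrimeValuationProduct.Negative

end
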